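import Mathlib
import Literature.Analysis.FluidPDE.VectorCalculus
import Summits.NavierStokesRegularity.NavierStokesRegularity.Theorems.FilamentSkeletonRssSkeletonEquilibriumForcedSlopeLaw
import Summits.NavierStokesRegularity.NavierStokesRegularity.Theorems.SkeletonEquilibrium.Negative.StrainIdentity
import Summits.NavierStokesRegularity.NavierStokesRegularity.Theorems.FilamentSkeletonRssTransverseReductionRCensus

/-!
# Route `FilamentSkeletonRss` · crux `SelectionBoxRJ` (stmt-NavierStokesRegularity-21220) — rung tools:
# the full-slip law of the forced local-induction model and the localisation of the stagnation-zero clause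

Lane `ns-filament-19175-p1` (g6), director-ns g9 ORDER OF WORK l.3062 (B)(iii) (bc5 rung for the deciding crux
`SelectionBoxRJ`; this lane covers the witness duty).  Helper file `--supports stmt-NavierStokesRegularity-21220`.
Companion memo `SIGMA-SCALING-21220.md` (item evidence).

THE QUESTION.  Clause 11 of the box asks, on every filament, for a UNIQUE zero `c_j` of the tangential speed
`w_j = ⟪v(X_j), X_j′⟫` with supercritical slope `3/2 + δ ≤ w_j′(c_j) ≤ Λ`, while clause 7 imposes exact tangency on
the ball `‖X‖ ≤ Rb√(Γ log Γ)`, whose radius in waist units `√Γ` grows like `√(log Γ)`.  The one adverse numerical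
mechanism of record (lane g5, RESULTS-21220-rball.md: beyond `R*(Γ) ≈ 1.12 / 1.24 / 1.42` waist units at
`Γ = 10⁴ / 10⁵ / 10⁶` the exactly tangent branch of the `R_π` datum grows EXTRA zeros of `w` on its gyrating arm) asks:
can uniqueness of the zero survive on an in-ball arc whose length tends to infinity?

WHAT IS PROVED (all `Γ`-free calculus; MODEL = the forced local-induction ("Lorentz-force") filament equation of the
tree's `SkeletonEquilibrium.Sketch` toolbox, `X″ = η X′ × (V(X) + U)`, `V y = ½ y − α e₃ × y` the rotating Leray drift,
`U` the frozen non-local velocity along the filament, `η = 4π/(γΛ)` the inverse local-induction coefficient):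

* `cross_cross_eq_inner_smul_sub` — `a × (a × b) = ⟪a, b⟫ a − ‖a‖² b` (linearity of `cross` in its second slot
  is Mathlib's `map_add`/`map_smul` for the tree's bundled `crossCLM`; `⟪a × b, b⟫ = 0` is the landed
  `TransverseReductionRCensus.inner_cross_self_right`).
* `liaModel_tangency` — in the model, tangency is AUTOMATIC: for a unit-speed solution and `η ≠ 0`,
  `η⁻¹ (X′ × X″) + U + V(X) = ⟪X′, V(X) + U⟫ X′`; i.e. the local-induction velocity `η⁻¹ X′ × X″` plus forcing plus
  drift is tangent with FULL slip `w = ⟪X′, V(X) + U⟫` (the box's `w`, clause 6, in the model).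
* `liaModel_slip_hasDerivAt` / `liaModel_slip_deriv` — the **full-slip law** `w′ = ½ + ⟪U′, X′⟫`: the `η`-terms of the
  drift-slip law `g′ = ½ − η⟪U, X′ × V(X)⟫` (`stub_forcedSlopeLaw`, landed) CANCEL against the curvature term
  `⟪X″, U⟫ = η⟪X′ × V(X), U⟫`.  Neither the size of the drift `V(X)` (which grows along the arc) nor the gyration rate
  `η‖V‖` enters: only the axial derivative of the forcing does.
* `liaModel_slip_strictMonoOn`, `liaModel_slip_zero_unique` — hence on any interval where `⟪U′, X′⟫ > −½` (in
  particular where `‖U′‖ < ½`) the full slip is strictly increasing and has AT MOST ONE zero.  For the partner field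
  of a filament of circulation parameter `γ_k` at distance `D√Γ` the forcing derivative is `≤ γ_k/(2πD²)` in these
  units, so extra zeros are confined to the `Γ`-INDEPENDENT zone `γ_k/(2πD²) ≥ ½` around the waist — the memo's
  reading of `R*`.
* `box_slip_deriv`, `box_slip_strictMonoOn`, `box_slip_zero_unique` — the same localisation in the ROUTE's
  vocabulary, for ANY datum of the box: with `X` `C²` unit speed and `w` differentiable (clause 2),
  `w′ = ½ + ⟪(w X′ − V(X))′, X′⟫` identically (`SkeletonEquilibrium.Negative.strain_identity`, landed), and on the
  tangency ball `w X′ − V(X)` IS the skeleton's regularised Biot–Savart velocity along the filament (clause 7); so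
  `w_j` is strictly monotone, with at most one zero, on every in-ball interval along which the skeleton's axial
  Biot–Savart strain exceeds `−½`.
* `differentiableAt_of_normalBlock`, `box_eigenvector_law` — census add-on for clause 12: its strict trace
  inequality forces `v` to be differentiable at the stagnation point (else `fderiv = 0`), and then tangency near
  `c` with `w(c) = 0` gives `A X′(c) = w′(c) X′(c)` — the tangent is an EXACT eigenvector of `A = Dv(X(c))` with the
  supercritical eigenvalue `w′(c) ∈ [3/2 + δ, Λ]`; clause 12 only constrains the normal block.

HONEST FRAMING.  Model-level and bookkeeping lemmas for the rung ladder of a HYPOTHETICAL filament box (R1 layer: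
the LIA balance); NOT an instance of `SelectionBoxRJ`, and nothing here is a claim about Navier–Stokes regularity or
blow-up.
-/

set_option linter.dupNamespace false

noncomputable section

namespace Summit.NavierStokesRegularity.NavierStokesRegularity.Theorems

open Set Function Filter Real
open Literature.Analysis.FluidPDE
open scoped InnerProductSpace Topology

namespace SelectionBoxRJRung

/-! ### Vector algebra -/

/-- The vector triple product on `ℝ³`: `a × (a × b) = ⟪a, b⟫ a − ‖a‖² b`. [folklore] -/
theorem cross_cross_eq_inner_smul_sub (a b : EuclideanSpace ℝ (Fin 3)) :
    cross a (cross a b) = ⟪a, b⟫_ℝ • a - ‖a‖ ^ 2 • b := by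
  rw [EuclideanSpace.real_norm_sq_eq]
  ext i
  fin_cases i <;>
    simp [cross, crossProduct, PiLp.inner_apply, Fin.sum_univ_three] <;> ring

/-! ### The forced local-induction model: tangency and the full-slip law -/

/-- **Model tangency.** For a unit vector `a` (the tangent `X′ t`), vectors `y` (the point `X t`) and `u` (the
forcing `U t`) and `η ≠ 0`: if `n = η • a × (V y + u)` (the model's `X″ t`) then
`η⁻¹ • (a × n) + u + V y = ⟪a, V y + u⟫ • a` — the local-induction velocity plus forcing plus drift is tangent,
with slip `⟪a, V y + u⟫`. [folklore] -/
theorem liaModel_tangency (η α : ℝ) (hη : η ≠ 0) (a y u n : EuclideanSpace ℝ (Fin 3)) (ha : ‖a‖ = 1)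
    (hn : n = η • cross a ((1 / 2 : ℝ) • y - α • cross (EuclideanSpace.single 2 1) y + u)) :
    η⁻¹ • cross a n + u + ((1 / 2 : ℝ) • y - α • cross (EuclideanSpace.single 2 1) y) =
      ⟪a, ((1 / 2 : ℝ) • y - α • cross (EuclideanSpace.single 2 1) y) + u⟫_ℝ • a := by
  have hsm : ∀ (r : ℝ) (b : EuclideanSpace ℝ (Fin 3)), cross a (r • b) = r • cross a b :=
    fun r b => map_smul (crossCLM a) r b
  rw [hn, hsm, smul_smul, inv_mul_cancel₀ hη, one_smul, cross_cross_eq_inner_smul_sub, ha,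
    one_pow, one_smul]
  abel

/-- **Full-slip law of the forced local-induction model (HasDerivAt form).** Let `X` be a `C²` unit-speed
solution of `X″ = η X′ × (V(X) + U)` (`V y = ½ y − α e₃ × y`) with differentiable forcing `U`.  Then the full
slip `w s = ⟪X′ s, V(X s) + U s⟫` has derivative `½ + ⟪U′ t, X′ t⟫` at every `t`: the drift-slip law
`stub_forcedSlopeLaw` gives `½ − η⟪U, X′ × V(X)⟫` for the first summand, the product rule and the equation give
`η⟪X′ × V(X), U⟫ + ⟪X′, U′⟫` for `⟪X′, U⟫`, and the `η`-terms cancel. [folklore] -/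
theorem liaModel_slip_hasDerivAt {η α : ℝ} {U X : ℝ → EuclideanSpace ℝ (Fin 3)}
    (hX : ContDiff ℝ 2 X) (hunit : ∀ t, ‖deriv X t‖ = 1)
    (hode : ∀ t, iteratedDeriv 2 X t = η • cross (deriv X t)
      ((1 / 2 : ℝ) • X t - α • cross (EuclideanSpace.single 2 1) (X t) + U t))
    (hU : Differentiable ℝ U) (t : ℝ) :
    HasDerivAt (fun s => ⟪deriv X s,
        ((1 / 2 : ℝ) • X s - α • cross (EuclideanSpace.single 2 1) (X s)) + U s⟫_ℝ)
      (1 / 2 + ⟪deriv U t, deriv X t⟫_ℝ) t := by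
  have hXd : Differentiable ℝ X := hX.differentiable (by norm_num)
  have hTd : Differentiable ℝ (deriv X) := hX.differentiable_deriv_two
  have h2 : iteratedDeriv 2 X = deriv (deriv X) := by
    rw [iteratedDeriv_succ, iteratedDeriv_one]
  have hX'' : deriv (deriv X) t = η • cross (deriv X t)
      ((1 / 2 : ℝ) • X t - α • cross (EuclideanSpace.single 2 1) (X t) + U t) := by
    rw [← h2, hode t]
  -- the drift slip `g`
  set g : ℝ → ℝ := fun s => ⟪deriv X s,
    (1 / 2 : ℝ) • X s - α • cross (EuclideanSpace.single 2 1) (X s)⟫_ℝ with hg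
  have hVd : Differentiable ℝ (fun s => (1 / 2 : ℝ) • X s -
      α • cross (EuclideanSpace.single (2 : Fin 3) (1 : ℝ)) (X s)) := by
    have h1 : Differentiable ℝ (fun s => cross (EuclideanSpace.single (2 : Fin 3) (1 : ℝ)) (X s)) := by
      have : (fun s => cross (EuclideanSpace.single (2 : Fin 3) (1 : ℝ)) (X s)) =
          (crossCLM (EuclideanSpace.single (2 : Fin 3) (1 : ℝ))) ∘ X := by
        funext s; simp [crossCLM_apply]
      rw [this]
      exact (crossCLM (EuclideanSpace.single (2 : Fin 3) (1 : ℝ))).differentiable.comp hXd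
    exact (hXd.const_smul (1 / 2 : ℝ)).sub (h1.const_smul α)
  have hgd : DifferentiableAt ℝ g t := ((hTd t).inner ℝ (hVd t))
  have hg' : HasDerivAt g (1 / 2 - η * ⟪U t, cross (deriv X t)
      ((1 / 2 : ℝ) • X t - α • cross (EuclideanSpace.single 2 1) (X t))⟫_ℝ) t := by
    have h := SkeletonEquilibrium.Sketch.stub_forcedSlopeLaw η α U X hX hunit hode t
    rw [← h]
    exact hgd.hasDerivAt
  -- the forcing slip `⟪X′, U⟫`
  have hh' : HasDerivAt (fun s => ⟪deriv X s, U s⟫_ℝ)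
      (⟪deriv X t, deriv U t⟫_ℝ + ⟪deriv (deriv X) t, U t⟫_ℝ) t :=
    (hTd t).hasDerivAt.inner ℝ (hU t).hasDerivAt
  have hsum := hg'.add hh'
  have hfun : (fun s => ⟪deriv X s,
      ((1 / 2 : ℝ) • X s - α • cross (EuclideanSpace.single 2 1) (X s)) + U s⟫_ℝ) =
      fun s => g s + ⟪deriv X s, U s⟫_ℝ := by
    funext s; rw [hg, inner_add_right]
  rw [hfun]
  refine hsum.congr_deriv ?_
  have hadd : ∀ b c : EuclideanSpace ℝ (Fin 3), cross (deriv X t) (b + c) = cross (deriv X t) b + cross (deriv X t) c :=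
    fun b c => map_add (crossCLM (deriv X t)) b c
  rw [hX'', real_inner_smul_left, hadd, inner_add_left, TransverseReductionRCensus.inner_cross_self_right,
    add_zero, real_inner_comm (U t), real_inner_comm (deriv X t) (deriv U t)]
  ring

/-- **Full-slip law of the forced local-induction model (`deriv` form):** `w′ t = ½ + ⟪U′ t, X′ t⟫`. [folklore] -/
theorem liaModel_slip_deriv {η α : ℝ} {U X : ℝ → EuclideanSpace ℝ (Fin 3)}
    (hX : ContDiff ℝ 2 X) (hunit : ∀ t, ‖deriv X t‖ = 1)
    (hode : ∀ t, iteratedDeriv 2 X t = η • cross (deriv X t)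
      ((1 / 2 : ℝ) • X t - α • cross (EuclideanSpace.single 2 1) (X t) + U t))
    (hU : Differentiable ℝ U) (t : ℝ) :
    deriv (fun s => ⟪deriv X s,
        ((1 / 2 : ℝ) • X s - α • cross (EuclideanSpace.single 2 1) (X s)) + U s⟫_ℝ) t =
      1 / 2 + ⟪deriv U t, deriv X t⟫_ℝ :=
  (liaModel_slip_hasDerivAt hX hunit hode hU t).deriv

/-! ### Monotonicity: at most one stagnation zero where the forcing strain exceeds `−½` -/

/-- A differentiable real function whose derivative is positive on a convex set is strictly monotone there.
[folklore] -/
theorem strictMonoOn_of_hasDerivAt_pos {f : ℝ → ℝ} {f' : ℝ → ℝ} {D : Set ℝ} (hD : Convex ℝ D)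
    (hf : ∀ x ∈ D, HasDerivAt f (f' x) x) (hpos : ∀ x ∈ D, 0 < f' x) : StrictMonoOn f D := by
  refine strictMonoOn_of_deriv_pos hD ?_ ?_
  · exact fun x hx => (hf x hx).continuousAt.continuousWithinAt
  · intro x hx
    have hxD : x ∈ D := interior_subset hx
    rw [(hf x hxD).deriv]
    exact hpos x hxD

/-- A strictly monotone function has at most one zero on its domain of monotonicity. [folklore] -/
theorem zero_unique_of_strictMonoOn {f : ℝ → ℝ} {D : Set ℝ} (hf : StrictMonoOn f D) {a b : ℝ}
    (ha : a ∈ D) (hb : b ∈ D) (hfa : f a = 0) (hfb : f b = 0) : a = b :=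
  hf.injOn ha hb (hfa.trans hfb.symm)

/-- **In the forced local-induction model the full slip is strictly increasing wherever the axial derivative of
the forcing exceeds `−½`.** [folklore] -/
theorem liaModel_slip_strictMonoOn {η α : ℝ} {U X : ℝ → EuclideanSpace ℝ (Fin 3)}
    (hX : ContDiff ℝ 2 X) (hunit : ∀ t, ‖deriv X t‖ = 1)
    (hode : ∀ t, iteratedDeriv 2 X t = η • cross (deriv X t)
      ((1 / 2 : ℝ) • X t - α • cross (EuclideanSpace.single 2 1) (X t) + U t))
    (hU : Differentiable ℝ U) {D : Set ℝ} (hD : Convex ℝ D)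
    (hstrain : ∀ t ∈ D, -(1 / 2 : ℝ) < ⟪deriv U t, deriv X t⟫_ℝ) :
    StrictMonoOn (fun s => ⟪deriv X s,
        ((1 / 2 : ℝ) • X s - α • cross (EuclideanSpace.single 2 1) (X s)) + U s⟫_ℝ) D :=
  strictMonoOn_of_hasDerivAt_pos hD (fun t _ => liaModel_slip_hasDerivAt hX hunit hode hU t)
    (fun t ht => by linarith [hstrain t ht])

/-- **At most one stagnation zero** of the model's full slip on a convex parameter set along which
`‖U′‖ < ½` (Cauchy–Schwarz: `⟪U′, X′⟫ ≥ −‖U′‖` for the unit tangent). [folklore] -/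
theorem liaModel_slip_zero_unique {η α : ℝ} {U X : ℝ → EuclideanSpace ℝ (Fin 3)}
    (hX : ContDiff ℝ 2 X) (hunit : ∀ t, ‖deriv X t‖ = 1)
    (hode : ∀ t, iteratedDeriv 2 X t = η • cross (deriv X t)
      ((1 / 2 : ℝ) • X t - α • cross (EuclideanSpace.single 2 1) (X t) + U t))
    (hU : Differentiable ℝ U) {D : Set ℝ} (hD : Convex ℝ D)
    (hsmall : ∀ t ∈ D, ‖deriv U t‖ < 1 / 2) {a b : ℝ} (ha : a ∈ D) (hb : b ∈ D)
    (hwa : ⟪deriv X a, ((1 / 2 : ℝ) • X a - α • cross (EuclideanSpace.single 2 1) (X a)) + U a⟫_ℝ = 0)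
    (hwb : ⟪deriv X b, ((1 / 2 : ℝ) • X b - α • cross (EuclideanSpace.single 2 1) (X b)) + U b⟫_ℝ = 0) :
    a = b := by
  have hstrain : ∀ t ∈ D, -(1 / 2 : ℝ) < ⟪deriv U t, deriv X t⟫_ℝ := by
    intro t ht
    have hcs : |⟪deriv U t, deriv X t⟫_ℝ| ≤ ‖deriv U t‖ * ‖deriv X t‖ := abs_real_inner_le_norm _ _
    rw [hunit t, mul_one] at hcs
    have := neg_abs_le (⟪deriv U t, deriv X t⟫_ℝ)
    linarith [hsmall t ht]
  exact zero_unique_of_strictMonoOn (liaModel_slip_strictMonoOn hX hunit hode hU hD hstrain) ha hb hwa hwb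

/-! ### The same localisation in the route's vocabulary (any box datum) -/

/-- **Slip derivative of a box datum.** For a `C²` unit-speed filament `X` and a differentiable tangential speed
`w` (clauses 2 of `SelectionBoxRJ` / `TransverseReductionRJ`), with `V y = ½ y − α e₃ × y`:
`w′ τ = ½ + ⟪(w X′ − V(X))′ τ, X′ τ⟫` for every `τ` — the landed `strain_identity` applied to the field
`F = w X′ − V(X)`, which on the tangency ball (clause 7: `v(X τ) = w τ X′ τ`, `v = u_X + V`) IS the skeleton's
regularised Biot–Savart velocity `u_X(X τ)` along the filament. [folklore] -/
theorem box_slip_deriv {α : ℝ} {X : ℝ → EuclideanSpace ℝ (Fin 3)} {w : ℝ → ℝ}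
    (hX : ContDiff ℝ 2 X) (hunit : ∀ τ, ‖deriv X τ‖ = 1) (hw : Differentiable ℝ w) (τ : ℝ) :
    deriv w τ = 1 / 2 + ⟪deriv (fun σ => w σ • deriv X σ -
        ((1 / 2 : ℝ) • X σ - α • cross (EuclideanSpace.single 2 1) (X σ))) τ, deriv X τ⟫_ℝ := by
  have hXd : Differentiable ℝ X := hX.differentiable (by norm_num)
  have hTd : Differentiable ℝ (deriv X) := hX.differentiable_deriv_two
  have hVd : Differentiable ℝ (fun s => (1 / 2 : ℝ) • X s -
      α • cross (EuclideanSpace.single (2 : Fin 3) (1 : ℝ)) (X s)) := by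
    have h1 : Differentiable ℝ (fun s => cross (EuclideanSpace.single (2 : Fin 3) (1 : ℝ)) (X s)) := by
      have : (fun s => cross (EuclideanSpace.single (2 : Fin 3) (1 : ℝ)) (X s)) =
          (crossCLM (EuclideanSpace.single (2 : Fin 3) (1 : ℝ))) ∘ X := by
        funext s; simp [crossCLM_apply]
      rw [this]
      exact (crossCLM (EuclideanSpace.single (2 : Fin 3) (1 : ℝ))).differentiable.comp hXd
    exact (hXd.const_smul (1 / 2 : ℝ)).sub (h1.const_smul α)
  have hF : Differentiable ℝ (fun σ => w σ • deriv X σ -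
      ((1 / 2 : ℝ) • X σ - α • cross (EuclideanSpace.single 2 1) (X σ))) :=
    (hw.smul hTd).sub hVd
  exact SkeletonEquilibrium.Negative.strain_identity (α := α) hX hunit hF (fun σ => by abel) τ

/-- **Localisation of the stagnation-zero clause.** For a box datum as in `box_slip_deriv`, on any convex
parameter set `D` along which the axial strain of the field `w X′ − V(X)` (= the skeleton's Biot–Savart velocity on
the tangency ball) exceeds `−½`, the tangential speed `w` is strictly increasing. [folklore] -/
theorem box_slip_strictMonoOn {α : ℝ} {X : ℝ → EuclideanSpace ℝ (Fin 3)} {w : ℝ → ℝ}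
    (hX : ContDiff ℝ 2 X) (hunit : ∀ τ, ‖deriv X τ‖ = 1) (hw : Differentiable ℝ w) {D : Set ℝ}
    (hD : Convex ℝ D)
    (hstrain : ∀ τ ∈ D, -(1 / 2 : ℝ) < ⟪deriv (fun σ => w σ • deriv X σ -
        ((1 / 2 : ℝ) • X σ - α • cross (EuclideanSpace.single 2 1) (X σ))) τ, deriv X τ⟫_ℝ) :
    StrictMonoOn w D := by
  refine strictMonoOn_of_hasDerivAt_pos hD (fun τ _ => (hw τ).hasDerivAt) fun τ hτ => ?_
  rw [box_slip_deriv (α := α) hX hunit hw τ]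
  linarith [hstrain τ hτ]

/-- **At most one stagnation zero** of `w` on such a set: any two zeros of `w` in `D` coincide.  (Clause 11 of the
box demands exactly this on the whole line; by this lemma it can only fail where the skeleton's axial strain is
`≤ −½`.) [folklore] -/
theorem box_slip_zero_unique {α : ℝ} {X : ℝ → EuclideanSpace ℝ (Fin 3)} {w : ℝ → ℝ}
    (hX : ContDiff ℝ 2 X) (hunit : ∀ τ, ‖deriv X τ‖ = 1) (hw : Differentiable ℝ w) {D : Set ℝ}
    (hD : Convex ℝ D)
    (hstrain : ∀ τ ∈ D, -(1 / 2 : ℝ) < ⟪deriv (fun σ => w σ • deriv X σ -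
        ((1 / 2 : ℝ) • X σ - α • cross (EuclideanSpace.single 2 1) (X σ))) τ, deriv X τ⟫_ℝ)
    {a b : ℝ} (ha : a ∈ D) (hb : b ∈ D) (hwa : w a = 0) (hwb : w b = 0) : a = b :=
  zero_unique_of_strictMonoOn (box_slip_strictMonoOn (α := α) hX hunit hw hD hstrain) ha hb hwa hwb

/-! ### Census add-on for clause 12: the tangent is an exact eigenvector of `A = Dv(X(c))` -/

/-- The strict normal-trace inequality of clause 12, `⟪A m, m⟫ + ⟪A n, n⟫ < 0` with `A = fderiv ℝ v x`, forces `v`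
to be differentiable at `x` (otherwise `fderiv` is the junk value `0`). [folklore] -/
theorem differentiableAt_of_normalBlock {v : EuclideanSpace ℝ (Fin 3) → EuclideanSpace ℝ (Fin 3)}
    {x m n : EuclideanSpace ℝ (Fin 3)}
    (h : ⟪fderiv ℝ v x m, m⟫_ℝ + ⟪fderiv ℝ v x n, n⟫_ℝ < 0) : DifferentiableAt ℝ v x := by
  by_contra hv
  rw [fderiv_zero_of_not_differentiableAt hv] at h
  simp at h

/-- **Eigenvector law.** Let `X` be `C²`, `w` differentiable with `w c = 0`, and `v` a field differentiable at
`X c` which is tangent along the filament near `c`, `v (X τ) = w τ • X′ τ` for `τ` in a neighbourhood of `c`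
(clause 7 near the stagnation point).  Then `(fderiv ℝ v (X c)) (X′ c) = w′(c) • X′ c`: the tangent is an exact
eigenvector of `A = Dv(X(c))` (clause-12's `A`) with eigenvalue the supercritical slope `w′(c)`. [folklore] -/
theorem box_eigenvector_law {v : EuclideanSpace ℝ (Fin 3) → EuclideanSpace ℝ (Fin 3)}
    {X : ℝ → EuclideanSpace ℝ (Fin 3)} {w : ℝ → ℝ} {c : ℝ}
    (hX : ContDiff ℝ 2 X) (hw : Differentiable ℝ w) (hwc : w c = 0)
    (hv : DifferentiableAt ℝ v (X c))
    (htan : ∀ᶠ τ in 𝓝 c, v (X τ) = w τ • deriv X τ) :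
    fderiv ℝ v (X c) (deriv X c) = deriv w c • deriv X c := by
  have hXd : Differentiable ℝ X := hX.differentiable (by norm_num)
  have hTd : Differentiable ℝ (deriv X) := hX.differentiable_deriv_two
  -- chain rule for `v ∘ X`
  have h1 : HasDerivAt (fun τ => v (X τ)) (fderiv ℝ v (X c) (deriv X c)) c :=
    hv.hasFDerivAt.comp_hasDerivAt c (hXd c).hasDerivAt
  -- product rule for `w • X′`
  have h2 : HasDerivAt (fun τ => w τ • deriv X τ) (w c • deriv (deriv X) c + deriv w c • deriv X c) c :=
    (hw c).hasDerivAt.smul (hTd c).hasDerivAt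
  have h3 : HasDerivAt (fun τ => v (X τ)) (w c • deriv (deriv X) c + deriv w c • deriv X c) c :=
    h2.congr_of_eventuallyEq htan
  have := h1.unique h3
  rw [this, hwc, zero_smul, zero_add]

end SelectionBoxRJRung

end Summit.NavierStokesRegularity.NavierStokesRegularity.Theorems
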